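import Summits.CriticalPhenomena.Ising3DConformalLimit.Theorems.SynchronousCouplingJoiningsTransfer
import Summits.CriticalPhenomena.Ising3DConformalLimit.Theorems.ExistsScaleCovariantLimit.Negative.TightnessUniqueness
import Summits.CriticalPhenomena.Ising3DConformalLimit.Theorems.MoebiusLimitExists.Negative.MeshContinuity
import HarnessLib

/-!
# Route `SynchronousCoupling`, crux `RotationJoining` (stmt-CriticalPhenomena-18763), line `SketchIdeator2` (reshape 2) —
# the rotation-invariant pinned scaling limit from the route's cruxes (lead's tool for `stub_isotropyTransfer`)

`isotropyLimit_of_joinings : DilationJoinings → UniformRegularity → ∃ S, (pinned pointwise limit of criticalCorr 3 under ρ_pin) ∧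
(S = 0 off NonCoincident) ∧ IsNondegenerateTwoPoint S ∧ IsTranslationInvariant S ∧ IsRotationInvariant S ∧ (S n continuous on NonCoincident)`.

Assembly of landed theorems only: `Cruxes.JoiningsTransfer.Sketch.existsScaleCovariantLimit_of_joinings` (DJ ∧ UR ⇒ item 1981),
`ExistsScaleCovariantLimitNegative.pinnedLimit_of_crux` (⇒ a full-filter pinned limit `S₀`), the normalisation lemmas
`normalised_hasLimit` / `normalised_nondeg` / `isTranslationInvariant_normalised_of_limit` / `exists_scaleCovariant_normalised`
(route MoebiusLimitExists, Negative lane), the tree's rotation theorem `LimitRotationInvariant_of HRP2Rigidity_of` (items 1980/1979 of route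
HyperoctahedralRP) applied to the normalised limit, and `LimitMeshContinuity.continuousOn_limit` (continuity off the diagonals).
References: G. Kozma, Acta Math. 199 (2007) §6 (architecture); H. Duminil-Copin, ICM 2022 §8.1 (the isotropy postulate this discharges
conditionally on DJ ∧ UR). No definitions, no sorry.
-/

noncomputable section

namespace Summit.CriticalPhenomena.Ising3DConformalLimit.Cruxes.RotationJoining.RateSplitting

open Literature.Probability.LatticeModels Filter Set
open scoped Topology
open Summit.CriticalPhenomena.Ising3DConformalLimit.Theses
open Summit.CriticalPhenomena.Ising3DConformalLimit.MoebiusLimitExistsOnlyInteraction (rhoPin)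
open Summit.CriticalPhenomena.Ising3DConformalLimit.MoebiusLimitExistsNegative
open Summit.CriticalPhenomena.Ising3DConformalLimit.ExistsScaleCovariantLimitNegative
open Summit.CriticalPhenomena.Ising3DConformalLimit.PinnedClusterPoints (cfg01_mem rescaled_pin_cfg01)
open Classical

/-- **The rotation-invariant pinned scaling limit of the critical `ℤ³` Ising correlators, from the route's cruxes.**
`DilationJoinings` (item 18762) and `UniformRegularity` (item 4658) give a correlation family `S` which is the pointwise scaling limit of
`criticalCorr 3` under the pinned renormalisation `ρ_pin(δ) = ⟨σ₀σ_{⌊1/δ⌋e₀}⟩^{-1/2}` (locally uniformly off the diagonals), vanishes off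
`NonCoincident`, has non-degenerate two-point function, is translation AND ROTATION invariant, and is continuous off the diagonals.
(DJ ∧ UR ⇒ `ExistsScaleCovariantLimit` by the landed `JoiningsTransfer` line ⇒ pinned limit; normalise; `LimitRotationInvariant_of HRP2Rigidity_of`.)
[folklore] -/
theorem isotropyLimit_of_joinings (hDJ : SynchronousCoupling.DilationJoinings) (hUR : SynchronousCoupling.UniformRegularity) :
    ∃ S : CorrFamily 3, HasPointwiseScalingLimit (criticalCorr 3) rhoPin S ∧
      (∀ n z, z ∉ NonCoincident 3 n → S n z = 0) ∧ IsNondegenerateTwoPoint S ∧ IsTranslationInvariant S ∧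
      IsRotationInvariant S ∧ (∀ n, ContinuousOn (S n) (NonCoincident 3 n)) := by
  obtain ⟨S₀, hlim₀⟩ := pinnedLimit_of_crux
    (Cruxes.JoiningsTransfer.Sketch.existsScaleCovariantLimit_of_joinings hDJ hUR)
  -- non-degeneracy of the raw limit: the pinned two-point value at `(0, e₀)` is `1`
  have h1 : S₀ 2 (![0, EuclideanSpace.single 0 1] : Fin 2 → EuclideanSpace ℝ (Fin 3)) = 1 := by
    have h := (hlim₀ 2).tendsto_at cfg01_mem
    simp_rw [rescaled_pin_cfg01] at h
    exact (tendsto_nhds_unique tendsto_const_nhds h).symm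
  have hnd₀ : IsNondegenerateTwoPoint S₀ :=
    (isNondegenerateTwoPoint_iff_exists_pos hlim₀).2 ⟨_, cfg01_mem, by rw [h1]; exact one_pos⟩
  have hρ : ∀ δ ∈ Set.Ioc (0:ℝ) 1, 0 < rhoPin δ := fun δ _ => rhoPin_pos' δ
  -- the normalised limit `S = S₀ · 𝟙_{NonCoincident}`
  have hlim : HasPointwiseScalingLimit (criticalCorr 3) rhoPin
      (fun n x => if x ∈ NonCoincident 3 n then S₀ n x else 0) := normalised_hasLimit hlim₀
  have hnorm : ∀ n z, z ∉ NonCoincident 3 n →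
      (fun n x => if x ∈ NonCoincident 3 n then S₀ n x else 0) n z = 0 := fun n z hz => if_neg hz
  have hnd : IsNondegenerateTwoPoint (fun n x => if x ∈ NonCoincident 3 n then S₀ n x else 0) :=
    normalised_nondeg hnd₀
  have htr : IsTranslationInvariant (fun n x => if x ∈ NonCoincident 3 n then S₀ n x else 0) :=
    isTranslationInvariant_normalised_of_limit hlim₀
  obtain ⟨Δ, -, hsc⟩ := exists_scaleCovariant_normalised hρ hlim₀ hnd₀
  have hrot : IsRotationInvariant (fun n x => if x ∈ NonCoincident 3 n then S₀ n x else 0) :=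
    Cruxes.LimitRotationInvariant.QuarterTurnLiouville.LimitRotationInvariant_of
      Cruxes.HRP2Rigidity.XRayMellin.HRP2Rigidity_of rhoPin Δ _ hρ hlim hnorm hnd htr hsc
  exact ⟨_, hlim, hnorm, hnd, htr, hrot, LimitMeshContinuity.continuousOn_limit hlim⟩

end Summit.CriticalPhenomena.Ising3DConformalLimit.Cruxes.RotationJoining.RateSplitting

end
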